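import Summits.Ventures.CertifiedManyBodySolver.Theses.TcThermcert1
import Summits.Ventures.CertifiedManyBodySolver.Theorems.TcThermcert1Defs
import Summits.Ventures.CertifiedManyBodySolver.Theorems.TcThermcert1VertexStubTrialGeneratorHook
import Literature.MathematicalPhysics.QuantumLattice.HubbardLocalSpinOperators
import HarnessLib

/-!
# Sketch — «Pauli–singlet split» of crux K1 `ThermalStiffnessCeilingU8b10_le_1o8` (route `TcThermcert1`, stmt-Ventures-26381)

Planner sketch (unit `hubbard-floor-idea-decomp-g0`, lens `decomp`, 2026-08-28). A TYPED SPLIT of the ONE joint certificate of the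
K1 line (`Lines/trialgen_b10.lean`, STUB 2 `TrialGeneratorCertificateAt β q`) for the interband (Schrieffer–Wolff / upper-Hubbard-band)
trial generator `a_SW = i(j⁺ − j⁻)` into SEVEN one-word, one-sided certificates on NAMED local observables plus two operator-algebra
statements and real arithmetic, glued by a PROVED theorem (`leafAt_of_singletSplit`, sorry-free) through the landed hook
`Vertex.stub_trialGeneratorHook`.

The lever is the exact Pauli identity on one bond `b = (0, e₁)` (verified exactly on the 16-dimensional two-site Fock space,
`calc/pauli_singlet_check.py`):
  `(j⁺_b)† j⁺_b = 4 (¼ n^s_0 n^s_{e₁} − S_0·S_{e₁})`,   `j⁺_b (j⁺_b)† = 4 (½(n^d_0 n^h_{e₁} + n^h_0 n^d_{e₁}) − ½(η†_0 η_{e₁} + η†_{e₁} η_0))`,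
(`j⁺_b` = the part of the bond current raising the double occupancy by one; only nearest-neighbour SINGLETS hop into a doublon).
It turns the only KMS-hard FLOOR of the one-word design (the floor on `X = ω([𝒥⁻,𝒥⁺]/|Λ|)`, idea card «graded-hypervirial-rebudget»)
into a CEILING on the nearest-neighbour spin correlation `ω(S_0·S_{e₁})` (antiferromagnetic short-range order), a docc-sector ceiling,
and a kinematic Fréchet floor.

HONEST FRAMING. Everything here is a one-sided CEILING chain on the thermal flux stiffness under hypotheses; the two operator statements
`PauliSingletIdentity`, `SWWordExpansionAt` and the admissibility `SWGenAdmissible` are stated, not proved, in this sketch; the seven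
certificates are hypotheses a certified solver would have to supply. Superconductivity in the Hubbard model is NOT proved by any of
this. No statement about an onset, a gap, a transition temperature or an order parameter is made or implied.
-/

noncomputable section

namespace Summit.Ventures.CertifiedManyBodySolver.Cruxes.ThermalStiffnessCeilingU8b10_le_1o8.SingletSplit

open Filter Topology Matrix Finset
open Literature.MathematicalPhysics.QuantumLattice
open Literature.MathematicalPhysics.QuantumLattice.ThermodynamicLimit
open Literature.MathematicalPhysics.QuantumFieldTheory
open Literature.MathematicalPhysics.StatisticalMechanics
open Literature.Probability.LatticeModels
open Summit.Ventures.CertifiedManyBodySolver.Observables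
open Summit.Ventures.CertifiedManyBodySolver.Theorems.TcThermcert1
open scoped ComplexConjugate ComplexOrder

/-! ## §0 Objects on the bond `b = (0, e₁)` inside `𝔄_{[-1,1]²}` -/

/-- membership of the origin in `[-1,1]²` (tree lemma, re-exported for brevity). -/
theorem h0 : (0 : Site 2) ∈ box 2 1 := zero_mem_box_one
/-- membership of `e₁` in `[-1,1]²`. -/
theorem h1 : (unitVec 0 : Site 2) ∈ box 2 1 := unitVec_zero_mem_box_one

/-- single-occupancy projector `n^s_x = n_{x↑} + n_{x↓} − 2 n_{x↑} n_{x↓}`. -/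
def singlyAt {Λ : Finset (Site 2)} (x : Site 2) (hx : x ∈ Λ) : FermionOp Λ :=
  nAt x hx 0 + nAt x hx 1 - (2 : ℂ) • (nAt x hx 0 * nAt x hx 1)

/-- doublon projector `n^d_x = n_{x↑} n_{x↓}`. -/
def doublonAt {Λ : Finset (Site 2)} (x : Site 2) (hx : x ∈ Λ) : FermionOp Λ :=
  nAt x hx 0 * nAt x hx 1

/-- holon projector `n^h_x = (1 − n_{x↑})(1 − n_{x↓})`. -/
def holonAt {Λ : Finset (Site 2)} (x : Site 2) (hx : x ∈ Λ) : FermionOp Λ :=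
  (1 - nAt x hx 0) * (1 - nAt x hx 1)

/-- on-site pair annihilator `η_x = c_{x↓} c_{x↑}`. -/
def etaAt {Λ : Finset (Site 2)} (x : Site 2) (hx : x ∈ Λ) : FermionOp Λ :=
  cAt x hx 1 * cAt x hx 0

/-- **`j⁺_b`**, the double-occupancy-RAISING part of the bond current
`j₀ = Σ_σ (−i c†_{e₁σ} c_{0σ} + i c†_{0σ} c_{e₁σ})` (`curBondObs`): a hop `y → x` raises the docc iff `n_{x σ̄} = 1` and `n_{y σ̄} = 0`. -/
def curPlus : FermionOp (box 2 1) :=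
  ∑ σ : Fin 2,
    ((-Complex.I) • ((cAt (unitVec 0) h1 σ)ᴴ * cAt 0 h0 σ) * (nAt (unitVec 0) h1 (1 - σ) * (1 - nAt 0 h0 (1 - σ))) +
      Complex.I • ((cAt 0 h0 σ)ᴴ * cAt (unitVec 0) h1 σ) * (nAt 0 h0 (1 - σ) * (1 - nAt (unitVec 0) h1 (1 - σ))))

/-- **The Schrieffer–Wolff / interband trial generator on the bond** `a_SW = i (j⁺_b − j⁻_b)`, `j⁻_b = (j⁺_b)†`
(translation sum `= O₁ = i(𝒥⁺ − 𝒥⁻)` of the idea card «graded-hypervirial-rebudget»). -/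
def swGen : FermionOp (box 2 1) :=
  Complex.I • (curPlus - curPlusᴴ)

/-- **nearest-neighbour singlet projector** `P^s_b = ¼ n^s_0 n^s_{e₁} − S_0·S_{e₁}`. -/
def singletProj : FermionOp (box 2 1) :=
  ((1 / 4 : ℝ) : ℂ) • (singlyAt 0 h0 * singlyAt (unitVec 0) h1) - spinDotAt 0 h0 (unitVec 0) h1

/-- **odd-channel doublon–holon projector** `P^DH_b = ½(n^d_0 n^h_{e₁} + n^h_0 n^d_{e₁}) − ½(η†_0 η_{e₁} + η†_{e₁} η_0)`. -/
def dhProj : FermionOp (box 2 1) :=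
  ((1 / 2 : ℝ) : ℂ) • (doublonAt 0 h0 * holonAt (unitVec 0) h1 + holonAt 0 h0 * doublonAt (unitVec 0) h1) -
    ((1 / 2 : ℝ) : ℂ) • ((etaAt 0 h0)ᴴ * etaAt (unitVec 0) h1 + (etaAt (unitVec 0) h1)ᴴ * etaAt 0 h0)

/-- the same-bond commutator `[j⁻_b, j⁺_b] ∈ 𝔄_{[-1,1]²}`. -/
def sameBondComm : FermionOp (box 2 1) :=
  curPlusᴴ * curPlus - curPlus * curPlusᴴ

/-- `[-1,1]² ⊆ [-2,2]²`. -/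
theorem b12 : box 2 1 ⊆ box 2 2 := box_subset_box (by norm_num)
/-- `[-1,1]² ⊆ [-5,5]²`. -/
theorem b15 : box 2 1 ⊆ box 2 5 := box_subset_box (by norm_num)
/-- `[-2,2]² ⊆ [-5,5]²`. -/
theorem b25 : box 2 2 ⊆ box 2 5 := box_subset_box (by norm_num)

/-- **`X`-density** `Σ_{z ∈ [-1,1]²} [τ_z j⁻_b, j⁺_b] ∈ 𝔄_{[-2,2]²}` — local density of `[𝒥⁻, 𝒥⁺]` (the word `X` of
«graded-hypervirial-rebudget»); only `z ∈ {0, ±e₁}` contribute. -/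
def xDens : FermionOp (box 2 2) :=
  commDensity (box 2 2) (box 2 1) b12 curPlusᴴ curPlus

/-- **cross-bond part of the `X`-density** (two collinear three-site words, the `t–J` "three-site term"):
`X₃ = xDens − Γ [j⁻_b, j⁺_b]`. -/
def xCross : FermionOp (box 2 2) :=
  xDens - fermionEmbed (PolySite.incl b12) sameBondComm

/-- docc-conserving part of the bond current `j⁰_b = j₀ − j⁺_b − j⁻_b`. -/
def curZero : FermionOp (box 2 1) :=
  curBondObs - curPlus - curPlusᴴ

/-- **`Y`-density** `Σ_z [τ_z j⁰_b, j⁺_b − j⁻_b] ∈ 𝔄_{[-2,2]²}` (the word `Y`; purely cross-bond since `[j⁰_b, j^±_b] = 0`). -/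
def yDens : FermionOp (box 2 2) :=
  commDensity (box 2 2) (box 2 1) b12 curZero (curPlus - curPlusᴴ)

/-- **`Z`-density**: the tree's double-commutator density of `a_SW` against the PURE KINETIC local Hamiltonian (`U = 0`, `t′ = 0`),
i.e. the local density of `[O₁, [K, O₁]]` (the word `Z`). -/
def zDens : FermionOp (box 2 5) :=
  doubleCommDensity 0 0 1 swGen

/-! ## §1 The three operator-side statements of the line (stated, not proved here) -/

/-- **FIRST LEMMA — the Pauli singlet / doublon–holon identities** (exact; checked on the two-site Fock space `ℂ^{16}`). -/
def PauliSingletIdentity : Prop :=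
  curPlusᴴ * curPlus = (4 : ℂ) • singletProj ∧ curPlus * curPlusᴴ = (4 : ℂ) • dhProj

/-- admissibility of the interband generator at every real amplitude (Hermitian, even, conserves `N` and `S^z`). -/
def SWGenAdmissible : Prop :=
  ∀ l : ℝ, IsTrialGenerator 1 ((l : ℂ) • swGen)

/-- torus-limit states of the canonical `(n = 7/8, S^z = 0)` Gibbs mixtures of the `t′ = 0`, `U = 8` torus model at inverse
temperature `β` along SOME divergent side sequence (verbatim the premise class of `TrialGeneratorHook`). -/
def IsAnchorTorusLimit (β : ℝ) (ω : InfVolFermionState 2) : Prop :=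
  ∃ Ls : ℕ → ℕ, Tendsto Ls atTop atTop ∧
    ω.IsTorusLimitOfMixture (sectorGibbsCount (7 / 8)) (fun L => sectorGibbsWeightTT' β 1 0 8 (7 / 8) L)
      (fun L => sectorGibbsVectorTT' 1 0 8 (7 / 8) L) Ls

/-- **Thermal SW word expansion at amplitude `l`** (idea-4's graded expansion `W = ½κ − l(2X+Y) + ½l²(Z + 2UX)`, `U = 8`, in
expectation on translation-invariant torus limits; an operator-level identity is false because `Σ_z[τ_z j⁺, j⁺] ≠ 0` as an operator). -/
def SWWordExpansionAt (β : ℝ) : Prop :=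
  ∀ ω : InfVolFermionState 2, IsAnchorTorusLimit β ω → ∀ l : ℝ,
    (ω.expect (box 2 5) (trialWord 0 8 1 ((l : ℂ) • swGen))).re =
      (1 / 2) * (ω.expect (box 2 1) (kinBondObsTT 0)).re - l * (2 - 8 * l) * (ω.expect (box 2 2) xDens).re
        - l * (ω.expect (box 2 2) yDens).re + (l ^ 2 / 2) * (ω.expect (box 2 5) zDens).re

/-! ## §2 The seven host-feedable pieces: one-word one-sided certificates on anchor torus limits -/

/-- certified CEILING `Re ω(A) ≤ c` on every anchor torus limit at `β`. -/
def WordCeiling (β : ℝ) {Λ : Finset (Site 2)} (A : FermionOp Λ) (c : ℝ) : Prop :=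
  ∀ ω : InfVolFermionState 2, IsAnchorTorusLimit β ω → (ω.expect Λ A).re ≤ c

/-- certified FLOOR `c ≤ Re ω(A)` on every anchor torus limit at `β`. -/
def WordFloor (β : ℝ) {Λ : Finset (Site 2)} (A : FermionOp Λ) (c : ℝ) : Prop :=
  ∀ ω : InfVolFermionState 2, IsAnchorTorusLimit β ω → c ≤ (ω.expect Λ A).re

/-! ## §3 The PROVED split -/

/-- expectation of the singlet projector in terms of the two named correlations. -/
theorem re_expect_singletProj (ω : InfVolFermionState 2) :
    (ω.expect (box 2 1) singletProj).re =
      (1 / 4) * (ω.expect (box 2 1) (singlyAt 0 h0 * singlyAt (unitVec 0) h1)).re -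
        (ω.expect (box 2 1) (spinDotAt 0 h0 (unitVec 0) h1)).re := by
  simp only [singletProj, map_sub, map_smul, smul_eq_mul, Complex.sub_re, Complex.re_ofReal_mul]

/-- the `X`-density splits as cross part + `4 P^s − 4 P^DH` in expectation, given the Pauli identity. -/
theorem re_expect_xDens (hP : PauliSingletIdentity) (ω : InfVolFermionState 2) :
    (ω.expect (box 2 2) xDens).re =
      (ω.expect (box 2 2) xCross).re + 4 * (ω.expect (box 2 1) singletProj).re - 4 * (ω.expect (box 2 1) dhProj).re := by
  have hx : xDens = xCross + fermionEmbed (PolySite.incl b12) sameBondComm := by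
    simp [xCross]
  have hs : sameBondComm = (4 : ℂ) • singletProj - (4 : ℂ) • dhProj := by
    rw [sameBondComm, hP.1, hP.2]
  rw [hx, map_add, ω.compatible b12, hs, map_sub, map_smul, map_smul]
  simp only [smul_eq_mul, Complex.add_re, Complex.sub_re, Complex.mul_re, Complex.re_ofNat, Complex.im_ofNat, zero_mul,
    sub_zero]
  ring

/-- **THE SPLIT (sorry-free).** Admissibility + Pauli identity + thermal SW expansion + SEVEN one-word one-sided certificates
(`κ⁺` kinetic ceiling, `s⁺` nearest-neighbour spin-correlation CEILING, `ν⁻` singly–singly floor, `π⁺` doublon–holon ceiling,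
`ξ⁻` three-site cross floor, `y⁻` `Y`-floor, `z⁺` `Z`-ceiling) + one line of real arithmetic at an amplitude `0 < l < 1/4`
⇒ the single-temperature leaf `ObsThermalStiffnessSeqCeilingAtBeta 0 8 (7/8) β q`. -/
theorem leafAt_of_singletSplit {β : ℝ} (hβ : 0 < β) {q : ℚ} (hA : SWGenAdmissible) (hP : PauliSingletIdentity)
    (hE : SWWordExpansionAt β) {l : ℝ} (hl0 : 0 < l) (hl1 : l < 1 / 4) {κ s ν π ξ y z : ℝ}
    (hκ : WordCeiling β (kinBondObsTT 0) κ)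
    (hs : WordCeiling β (spinDotAt 0 h0 (unitVec 0) h1 : FermionOp (box 2 1)) s)
    (hν : WordFloor β (singlyAt 0 h0 * singlyAt (unitVec 0) h1 : FermionOp (box 2 1)) ν)
    (hπ : WordCeiling β dhProj π) (hξ : WordFloor β xCross ξ) (hy : WordFloor β yDens y) (hz : WordCeiling β zDens z)
    (harith : κ / 2 - 4 * (l * (2 - 8 * l)) * (ν / 4 - s - π) - l * (2 - 8 * l) * ξ - l * y + l ^ 2 / 2 * z ≤ (q : ℝ)) :
    ObsThermalStiffnessSeqCeilingAtBeta 0 8 (7 / 8) β q := by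
  refine Vertex.stub_trialGeneratorHook hβ (by norm_num) (by norm_num) 1 ((l : ℂ) • swGen) (hA l) ?_
  intro ω Ls hLs hω
  have hω' : IsAnchorTorusLimit β ω := ⟨Ls, hLs, hω⟩
  rw [hE ω hω' l, re_expect_xDens hP ω, re_expect_singletProj ω]
  have hc : 0 < l * (2 - 8 * l) := mul_pos hl0 (by linarith)
  have h1 := hκ ω hω'
  have h2 := hs ω hω'
  have h3 := hν ω hω'
  have h4 := hπ ω hω'
  have h5 := hξ ω hω'
  have h6 := hy ω hω'
  have h7 := hz ω hω'
  have hl2 : 0 ≤ l ^ 2 / 2 := by positivity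
  nlinarith [mul_le_mul_of_nonneg_left h7 hl2, mul_le_mul_of_nonneg_left h6 hl0.le,
    mul_le_mul_of_nonneg_left h5 hc.le, mul_le_mul_of_nonneg_left h3 hc.le,
    mul_le_mul_of_nonneg_left h2 hc.le, mul_le_mul_of_nonneg_left h4 hc.le]

/-- **The split concludes the crux BY NAME** (`β·t = 10`, `q = 1/8`). -/
theorem ThermalStiffnessCeilingU8b10_le_1o8_of_singletSplit (hA : SWGenAdmissible) (hP : PauliSingletIdentity)
    (hE : SWWordExpansionAt 10) {l : ℝ} (hl0 : 0 < l) (hl1 : l < 1 / 4) {κ s ν π ξ y z : ℝ}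
    (hκ : WordCeiling 10 (kinBondObsTT 0) κ)
    (hs : WordCeiling 10 (spinDotAt 0 h0 (unitVec 0) h1 : FermionOp (box 2 1)) s)
    (hν : WordFloor 10 (singlyAt 0 h0 * singlyAt (unitVec 0) h1 : FermionOp (box 2 1)) ν)
    (hπ : WordCeiling 10 dhProj π) (hξ : WordFloor 10 xCross ξ) (hy : WordFloor 10 yDens y) (hz : WordCeiling 10 zDens z)
    (harith : κ / 2 - 4 * (l * (2 - 8 * l)) * (ν / 4 - s - π) - l * (2 - 8 * l) * ξ - l * y + l ^ 2 / 2 * z ≤ 1 / 8) :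
    Summit.Ventures.CertifiedManyBodySolver.Theses.TcThermcert1.ThermalStiffnessCeilingU8b10_le_1o8 := by
  unfold Summit.Ventures.CertifiedManyBodySolver.Theses.TcThermcert1.ThermalStiffnessCeilingU8b10_le_1o8
  have h := leafAt_of_singletSplit (q := 1 / 8) (by norm_num : (0 : ℝ) < 10) hA hP hE hl0 hl1 hκ hs hν hπ hξ hy hz
    (by push_cast; linarith)
  exact h

/-- **Rung form** (`β·t = 6` lever test `R1(6)`, `q = 21/100`): the same split at the director's pre-registered temperature. -/
theorem rung6_of_singletSplit (hA : SWGenAdmissible) (hP : PauliSingletIdentity) (hE : SWWordExpansionAt 6) {l : ℝ}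
    (hl0 : 0 < l) (hl1 : l < 1 / 4) {κ s ν π ξ y z : ℝ}
    (hκ : WordCeiling 6 (kinBondObsTT 0) κ)
    (hs : WordCeiling 6 (spinDotAt 0 h0 (unitVec 0) h1 : FermionOp (box 2 1)) s)
    (hν : WordFloor 6 (singlyAt 0 h0 * singlyAt (unitVec 0) h1 : FermionOp (box 2 1)) ν)
    (hπ : WordCeiling 6 dhProj π) (hξ : WordFloor 6 xCross ξ) (hy : WordFloor 6 yDens y) (hz : WordCeiling 6 zDens z)
    (harith : κ / 2 - 4 * (l * (2 - 8 * l)) * (ν / 4 - s - π) - l * (2 - 8 * l) * ξ - l * y + l ^ 2 / 2 * z ≤ 21 / 100) :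
    ObsThermalStiffnessSeqCeilingAtBeta 0 8 (7 / 8) 6 (21 / 100) :=
  leafAt_of_singletSplit (q := 21 / 100) (by norm_num : (0 : ℝ) < 6) hA hP hE hl0 hl1 hκ hs hν hπ hξ hy hz
    (by push_cast; linarith)

/-- **The seven-piece certificate at `(β, q)`** — the line-level replacement of the joint STUB 2 `TrialGeneratorCertificateAt β q` for the
interband generator: SOME admissible amplitude and SOME seven certified numbers satisfying the budget (numbers are outputs of a certified solver,
hence existentially quantified; each conjunct is one host objective). -/
def SevenPieceCertificateAt (β : ℝ) (q : ℚ) : Prop :=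
  ∃ l κ s ν π ξ y z : ℝ, 0 < l ∧ l < 1 / 4 ∧
    WordCeiling β (kinBondObsTT 0) κ ∧
    WordCeiling β (spinDotAt 0 h0 (unitVec 0) h1 : FermionOp (box 2 1)) s ∧
    WordFloor β (singlyAt 0 h0 * singlyAt (unitVec 0) h1 : FermionOp (box 2 1)) ν ∧
    WordCeiling β dhProj π ∧ WordFloor β xCross ξ ∧ WordFloor β yDens y ∧ WordCeiling β zDens z ∧
    κ / 2 - 4 * (l * (2 - 8 * l)) * (ν / 4 - s - π) - l * (2 - 8 * l) * ξ - l * y + l ^ 2 / 2 * z ≤ (q : ℝ)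

/-- line-shaped composition: three operator statements + the seven-piece certificate at `(β, q)` ⇒ the leaf. -/
theorem leafAt_of_sevenPiece {β : ℝ} (hβ : 0 < β) {q : ℚ} (hA : SWGenAdmissible) (hP : PauliSingletIdentity)
    (hE : SWWordExpansionAt β) (hC : SevenPieceCertificateAt β q) : ObsThermalStiffnessSeqCeilingAtBeta 0 8 (7 / 8) β q := by
  obtain ⟨l, κ, s, ν, π, ξ, y, z, hl0, hl1, hκ, hs, hν, hπ, hξ, hy, hz, harith⟩ := hC
  exact leafAt_of_singletSplit hβ hA hP hE hl0 hl1 hκ hs hν hπ hξ hy hz harith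

/-- **K1 from the four line stubs** (the shape a registered `Lines/singlet_split.lean` would have: `stub_admissible`, `stub_pauli`,
`stub_expansion_b10`, `stub_sevenPiece_b10` → the crux by name). -/
theorem ThermalStiffnessCeilingU8b10_le_1o8_of_stubs (hA : SWGenAdmissible) (hP : PauliSingletIdentity) (hE : SWWordExpansionAt 10)
    (hC : SevenPieceCertificateAt 10 (1 / 8)) :
    Summit.Ventures.CertifiedManyBodySolver.Theses.TcThermcert1.ThermalStiffnessCeilingU8b10_le_1o8 := by
  unfold Summit.Ventures.CertifiedManyBodySolver.Theses.TcThermcert1.ThermalStiffnessCeilingU8b10_le_1o8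
  exact leafAt_of_sevenPiece (by norm_num) hA hP hE hC

/-- rung socket of the same shape (`β·t = 6`, `q = 21/100`; and any `(β, q)` via `leafAt_of_sevenPiece`). -/
theorem rung6_of_stubs (hA : SWGenAdmissible) (hP : PauliSingletIdentity) (hE : SWWordExpansionAt 6)
    (hC : SevenPieceCertificateAt 6 (21 / 100)) : ObsThermalStiffnessSeqCeilingAtBeta 0 8 (7 / 8) 6 (21 / 100) :=
  leafAt_of_sevenPiece (by norm_num) hA hP hE hC

/-! ## §4 The threshold (pure arithmetic): ANY interband booking needs a spin certificate `s < ν/4 − π + (2ξ + y)/8`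

At small amplitude the gain over the kinematic ceiling `κ/2` is `l·(8(ν/4 − s − π) + 2ξ + y) + O(l²)`; so the seven-piece design books a
positive gain for some `l ∈ (0, 1/4)` only if `8(ν/4 − s − π) + 2ξ + y > 0`. With the cross words small this is a CEILING on the
nearest-neighbour spin correlation strictly below `ν/4 − π` (≈ `+0.08` at `(U, n) = (8, 7/8)` with `ν ≈ 0.51`, `π ≈ 0.05`). -/

/-- first-order gain criterion: if the linear coefficient is positive, some admissible amplitude gives a strict gain over `κ/2`. -/
theorem exists_gain_of_linear_pos {κ s ν π ξ y z : ℝ} (h : 0 < 8 * (ν / 4 - s - π) + 2 * ξ + y) :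
    ∃ l : ℝ, 0 < l ∧ l < 1 / 4 ∧
      κ / 2 - 4 * (l * (2 - 8 * l)) * (ν / 4 - s - π) - l * (2 - 8 * l) * ξ - l * y + l ^ 2 / 2 * z < κ / 2 := by
  -- gain(l) = l·A − l²·B with A > 0, B = 32(ν/4−s−π) + 8ξ + z/2 … take l small: l = min (1/8) (A / (2(|B|+1)))
  set A := 8 * (ν / 4 - s - π) + 2 * ξ + y with hAdef
  set B := 32 * (ν / 4 - s - π) + 8 * ξ + z / 2 with hBdef
  have key : ∀ l : ℝ, κ / 2 - 4 * (l * (2 - 8 * l)) * (ν / 4 - s - π) - l * (2 - 8 * l) * ξ - l * y + l ^ 2 / 2 * z =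
      κ / 2 - (l * A - l ^ 2 * B) := by intro l; rw [hAdef, hBdef]; ring
  refine ⟨min (1 / 8) (A / (2 * (|B| + 1))), ?_, ?_, ?_⟩
  · have : 0 < A / (2 * (|B| + 1)) := by positivity
    exact lt_min (by norm_num) this
  · exact (min_le_left _ _).trans_lt (by norm_num)
  · rw [key]
    set l := min (1 / 8) (A / (2 * (|B| + 1))) with hl
    have hl0 : 0 < l := lt_min (by norm_num) (by positivity)
    have hlA : l ≤ A / (2 * (|B| + 1)) := min_le_right _ _
    have hB1 : 0 < |B| + 1 := by positivity
    -- l·B ≤ l·|B| ≤ (A / (2(|B|+1)))·|B| < A/2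
    have hlB : l * B ≤ A / 2 := by
      calc l * B ≤ l * |B| := by exact mul_le_mul_of_nonneg_left (le_abs_self B) hl0.le
        _ ≤ A / (2 * (|B| + 1)) * |B| := by exact mul_le_mul_of_nonneg_right hlA (abs_nonneg B)
        _ = A / 2 * (|B| / (|B| + 1)) := by field_simp
        _ ≤ A / 2 * 1 := by
            refine mul_le_mul_of_nonneg_left ?_ (by linarith)
            rw [div_le_one hB1]; linarith
        _ = A / 2 := by ring
    have : 0 < l * A - l ^ 2 * B := by
      have : l ^ 2 * B = l * (l * B) := by ring
      rw [this]; nlinarith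
    linarith

end Summit.Ventures.CertifiedManyBodySolver.Cruxes.ThermalStiffnessCeilingU8b10_le_1o8.SingletSplit

end
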